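import Mathlib.NumberTheory.Padics.RingHoms
import Mathlib.GroupTheory.Torsion
import Mathlib.Tactic
import HarnessLib

/-!
# Crux `PrintCf2.SplitBadTwoRankOneOfFacts` (stmt-BirchSwinnertonDyer-20368), road α v11.1, S3b′ brick (FIN) via (ET), piece (B1) file 4:
# PURE ALGEBRA — an element acting on a divisible `p`-primary line by a `p`-adic scalar `c ≠ 1` has `σ − 1` SURJECTIVE on the line

Cell `bsd-print-cf2`, EXTRA WIDTH seat `bsd-line-cf2-p1-w8` g3 (prover-bsd-line-cf2-p1-w8-g3-0); `--supports stmt-BirchSwinnertonDyer-20368`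
(helper, Theses-free). HONEST FRAMING: nothing here closes the crux or a registered stub; BSD is not proved by any of this; no summit
statement is proved by this seat. No definition, no named fact, no `sorry`, no kit. beyond-print theorem: no.

WHY (the LOWER bound `W*′ ⊆ 𝒞` of step (iii) in TURNKEY-20368-ET-w3g10 §2, after p685969/p686370/KernelLineUpperBound). The transported kernel of
reduction `𝒞` contains `σm − m` for every inertia element `σ` fixing `√d` and every `m ∈ E[2^∞]` (Greenberg's Kummer compatibility / `htriv`).
The frame's local types (-w2 g8 p655423 `endEigenPrimaryTorsion_two_isOrdinaryFiltrationDatum_of_pinned`, p657782) say that such a `σ` acts on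
the graded pieces `W*′[2^k]` of the kernel line by INTEGER SCALARS `N ≡ c (mod 2^k)` for one `2`-adic unit `c = s₁·χ_cyc(σ)`. THIS FILE: if
`c ≠ 1` then `σ − 1` maps the line ONTO itself, so `W*′ = (σ − 1)W*′ ⊆ 𝒞`. Pure algebra: `c − 1 = p^a·u`; a `p^a`-th root `x₁` of `y` inside the
divisible line, rescaled by an integer `≡ u⁻¹`, is the required preimage (`PadicInt.unitCoeff`, `PadicInt.appr`, and the tree idiom
`zsmul_eq_zsmul_of_sub_mem_span`).
* `zsmul_eq_zsmul_of_sub_mem_span'` — integers congruent mod `p^k` in `ℤ_p` act alike on `p^k`-torsion (copy of -w3 g10's lemma, `p` generic,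
  stated for the difference to avoid an import of the CM files).
* `exists_nsmul_pow_eq_of_divisible` — a `p`-divisible subgroup has `p^a`-th roots.
* **`exists_sub_eq_of_scalar_ne_one`** — the surjectivity of `σ − 1` on the line (σ any additive map acting by graded scalars `≡ c`, `c ≠ 1`).
presearch: elementary `p`-adic algebra; no source. playbook: none fit.

References: [Rubin1999] §3 Lemma 3.6 (ii) (the scalar action on `E[𝔭^∞]`); [GreenbergLNM1716] §2 p. 70.
-/

set_option linter.dupNamespace false
set_option autoImplicit false

namespace Summit.BirchSwinnertonDyer.BirchSwinnertonDyer.Theorems.PrintCf2.ReductionKernel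

variable {A : Type*} [AddCommGroup A] {p : ℕ} [hp : Fact p.Prime]

/-- Two integers congruent modulo `p^k` in `ℤ_p` act alike on an element killed by `p^k`. [folklore] -/
theorem zsmul_eq_zsmul_of_sub_mem_span' {k : ℕ} {x : A} (hx : p ^ k • x = 0) {N N' : ℤ}
    (h : ((N : ℤ_[p]) - N') ∈ (Ideal.span {(p : ℤ_[p]) ^ k} : Ideal ℤ_[p])) : N • x = N' • x := by
  have h' : ((N - N' : ℤ) : ℤ_[p]) ∈ (Ideal.span {(p : ℤ_[p]) ^ k} : Ideal ℤ_[p]) := by push_cast; exact h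
  have hdvd : (p ^ k : ℤ) ∣ N - N' := by
    rw [← PadicInt.norm_int_le_pow_iff_dvd]
    exact (PadicInt.norm_le_pow_iff_mem_span_pow _ _).mpr h'
  obtain ⟨c, hc⟩ := hdvd
  have hpk : ((p : ℤ) ^ k) • x = 0 := by
    rw [show ((p : ℤ) ^ k) = ((p ^ k : ℕ) : ℤ) by push_cast; rfl, natCast_zsmul, hx]
  have h1 : (N - N') • x = 0 := by rw [hc, mul_comm, mul_zsmul, hpk, zsmul_zero]
  rwa [sub_smul, sub_eq_zero] at h1

omit hp in
/-- A `p`-divisible subgroup has `p^a`-th roots: `∀ y ∈ M, ∃ x ∈ M, p^a • x = y`. [folklore] -/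
theorem exists_nsmul_pow_eq_of_divisible (M : AddSubgroup A) (hdiv : ∀ y ∈ M, ∃ x ∈ M, p • x = y) (a : ℕ) :
    ∀ y ∈ M, ∃ x ∈ M, p ^ a • x = y := by
  induction a with
  | zero => exact fun y hy ↦ ⟨y, hy, by rw [pow_zero, one_smul]⟩
  | succ a ih =>
    intro y hy
    obtain ⟨x₁, hx₁, rfl⟩ := ih y hy
    obtain ⟨x, hx, rfl⟩ := hdiv x₁ hx₁
    exact ⟨x, hx, by rw [pow_succ, mul_smul]⟩

/-- **`σ − 1` IS SURJECTIVE ON A DIVISIBLE `p`-PRIMARY LINE ON WHICH `σ` ACTS BY A SCALAR `c ≠ 1`.** Let `M ≤ A` be `p`-primary and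
`p`-divisible, `f : A →+ A` (the action of `σ`), and `c ∈ ℤ_p` with `c ≠ 1` such that on `M[p^k]` the map `f` is multiplication by any integer
`N ≡ c (mod p^k)` (the graded scalar clause of the tree's local-type theorems). Then every `y ∈ M` is `f x − x` for some `x ∈ M`.
[cite: Rubin1999, §3 Lemma 3.6 (ii)] [cite: GreenbergLNM1716, §2 p. 70] -/
theorem exists_sub_eq_of_scalar_ne_one (M : AddSubgroup A) (hprim : ∀ y ∈ M, ∃ k : ℕ, p ^ k • y = 0)
    (hdiv : ∀ y ∈ M, ∃ x ∈ M, p • x = y) (f : A →+ A) {c : ℤ_[p]} (hc : c ≠ 1)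
    (hscalar : ∀ (k : ℕ), ∀ x ∈ M, p ^ k • x = 0 →
      ∀ N : ℤ, ((N : ℤ_[p]) - c) ∈ (Ideal.span {(p : ℤ_[p]) ^ k} : Ideal ℤ_[p]) → f x = N • x) :
    ∀ y ∈ M, ∃ x ∈ M, f x - x = y := by
  intro y hy
  obtain ⟨k, hk⟩ := hprim y hy
  -- `c − 1 = p^a · u`
  have hc1 : c - 1 ≠ 0 := sub_ne_zero.mpr hc
  set a : ℕ := (c - 1).valuation with ha
  set u : ℤ_[p]ˣ := PadicInt.unitCoeff hc1 with hu
  have hcu : c - 1 = (u : ℤ_[p]) * (p : ℤ_[p]) ^ a := PadicInt.unitCoeff_spec hc1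
  -- a `p^a`-th root of `y` in `M`, killed by `p^(k+a)`
  obtain ⟨x₁, hx₁, hx₁y⟩ := exists_nsmul_pow_eq_of_divisible M hdiv a y hy
  have hx₁k : p ^ (k + a) • x₁ = 0 := by rw [pow_add, mul_smul, hx₁y, hk]
  -- integers `m ≡ u⁻¹` and `N ≡ c` modulo `p^(k+a)`
  set m : ℕ := PadicInt.appr ((u⁻¹ : ℤ_[p]ˣ) : ℤ_[p]) (k + a) with hm
  have hm' : (((u⁻¹ : ℤ_[p]ˣ) : ℤ_[p]) - (m : ℤ_[p])) ∈ (Ideal.span {(p : ℤ_[p]) ^ (k + a)} : Ideal ℤ_[p]) :=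
    PadicInt.appr_spec (k + a) _
  set N : ℕ := PadicInt.appr c (k + a) with hN
  have hN' : (c - (N : ℤ_[p])) ∈ (Ideal.span {(p : ℤ_[p]) ^ (k + a)} : Ideal ℤ_[p]) := PadicInt.appr_spec (k + a) _
  refine ⟨(m : ℤ) • x₁, M.zsmul_mem hx₁ _, ?_⟩
  have hxk : p ^ (k + a) • ((m : ℤ) • x₁) = 0 := by rw [smul_comm, hx₁k, smul_zero]
  have hfx : f ((m : ℤ) • x₁) = (N : ℤ) • ((m : ℤ) • x₁) :=
    hscalar (k + a) _ (M.zsmul_mem hx₁ _) hxk N (by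
      have : ((N : ℤ) : ℤ_[p]) - c = -(c - (N : ℤ_[p])) := by push_cast; ring
      rw [this]
      exact (Ideal.neg_mem_iff _).mpr hN')
  -- the congruence `(N − 1)·m ≡ p^a (mod p^(k+a))`
  set I : Ideal ℤ_[p] := Ideal.span {(p : ℤ_[p]) ^ (k + a)} with hI
  have hcong : ((((N : ℤ) - 1) * (m : ℤ) : ℤ) : ℤ_[p]) - (((p ^ a : ℕ) : ℤ) : ℤ_[p]) ∈ I := by
    have h1 : ((N : ℤ_[p]) - c) * (m : ℤ_[p]) ∈ I := by
      refine I.mul_mem_right _ ?_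
      have : (N : ℤ_[p]) - c = -(c - (N : ℤ_[p])) := by ring
      rw [this]
      exact (Ideal.neg_mem_iff I).mpr hN'
    have h2 : (p : ℤ_[p]) ^ a * ((u : ℤ_[p]) * (m : ℤ_[p]) - 1) ∈ I := by
      refine I.mul_mem_left _ ?_
      have : (u : ℤ_[p]) * (m : ℤ_[p]) - 1 = (u : ℤ_[p]) * -(((u⁻¹ : ℤ_[p]ˣ) : ℤ_[p]) - (m : ℤ_[p])) := by
        rw [neg_sub, mul_sub, Units.mul_inv]
      rw [this]
      exact I.mul_mem_left _ ((Ideal.neg_mem_iff I).mpr hm')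
    have hc' : c = (u : ℤ_[p]) * (p : ℤ_[p]) ^ a + 1 := by rw [← hcu, sub_add_cancel]
    have : ((((N : ℤ) - 1) * (m : ℤ) : ℤ) : ℤ_[p]) - (((p ^ a : ℕ) : ℤ) : ℤ_[p]) =
        ((N : ℤ_[p]) - c) * (m : ℤ_[p]) + (p : ℤ_[p]) ^ a * ((u : ℤ_[p]) * (m : ℤ_[p]) - 1) := by
      rw [hc']
      push_cast
      ring
    rw [this]
    exact I.add_mem h1 h2
  have hmul : (N : ℤ) • ((m : ℤ) • x₁) - (m : ℤ) • x₁ = (((N : ℤ) - 1) * (m : ℤ)) • x₁ := by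
    rw [smul_smul, ← sub_smul]
    congr 1
    ring
  rw [hfx, hmul, zsmul_eq_zsmul_of_sub_mem_span' hx₁k hcong, natCast_zsmul, hx₁y]

end Summit.BirchSwinnertonDyer.BirchSwinnertonDyer.Theorems.PrintCf2.ReductionKernel

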